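import Mathlib.Analysis.Calculus.MeanValue
import Literature.Analysis.FunctionSpaces.ContDiffHolderBilinear
import HarnessLib

/-!
# Smooth maps act on `C^{k,r}_b` by post-composition (Hölder spaces, part 6)

Topic `Literature/Analysis/FunctionSpaces`. For the classes `C^{k,r}_b(E, F)` (`MemContDiffHolder`,
part 1; bundled in part 3) we prove that post-composition with a `C^{k+1}` map `φ : F → G` on a
finite-dimensional `F` preserves the class (`0 ≤ r ≤ 1`):
`u ∈ C^{k,r}_b(E, F) ⇒ φ ∘ u ∈ C^{k,r}_b(E, G)` (`MemContDiffHolder.comp_left`,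
`ContDiffHolderFunction.compLeft`). This is the classical remark that Hölder classes are stable
under smooth nonlinear maps of the value (Gilbarg–Trudinger 2001, §4.1 and Ch. 17 use it
silently for the coefficients `F(x, u, Du, D²u)`); it is what makes
`w ↦ backgroundPathOperator g t w − q e^{−4w}` a map `C^{2,α} → C^{0,α}` (brick (1e) of the
census of `Literature.Geometry.Riemannian.gurskyViaclovsky_pathOpen_weighted_four`).

Proof by induction on `k`, generalizing the target `G`:
* `k = 0`: the range of `u` lies in a compact ball of `F` on which `φ` is bounded and Lipschitz
  (mean value theorem, `Convex.lipschitzOnWith_of_nnnorm_fderiv_le`), so `φ ∘ u` is bounded and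
  `r`-Hölder;
* `k → k + 1`: `D(φ ∘ u) = (Dφ ∘ u) ∘L Du` (chain rule) is the continuous bilinear pairing
  `ContinuousLinearMap.compL` of `Dφ ∘ u ∈ C^{k,r}_b` (induction hypothesis for `Dφ : F → (F →L G)`)
  and `Du ∈ C^{k,r}_b` (derivative shift, `MemContDiffHolder.fderiv`), hence in `C^{k,r}_b` by part 5
  (`MemContDiffHolder.bilinear`); with `φ ∘ u` bounded this is membership in `C^{k+1,r}_b`
  (`memContDiffHolder_succ_iff`, from `eContDiffHolderNorm_succ_eq_fderiv`).

Also: `MemContDiffHolder.fderiv`, `MemContDiffHolder.of_succ` (`C^{k+1,r}_b ⊆ C^{k,r}_b`, `r ≤ 1`),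
`memContDiffHolder_succ_iff`. Everything is proved; no named facts. As in part 5, the spaces
`E, F, G` live in one universe (the Leibniz estimate of `ContDiffHolderLeibniz.lean` is so stated).

## References

* D. Gilbarg, N. S. Trudinger, *Elliptic Partial Differential Equations of Second Order* (2001),
  §4.1. [GilbargTrudinger2001]
-/

noncomputable section

open Set Filter Metric
open scoped NNReal ENNReal

universe u

namespace Literature.Analysis.FunctionSpaces

/-! ### Derivative shift and order reduction on the classes -/

section Shift

variable {E F : Type*} [NormedAddCommGroup E] [NormedSpace ℝ E] [NormedAddCommGroup F]
  [NormedSpace ℝ F] {k : ℕ} {r : ℝ≥0}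

/-- **Derivative shift**: `u ∈ C^{k+1,r}_b ⇒ Du ∈ C^{k,r}_b` (`‖u‖_{k+1,r} = ‖u‖_∞ + ‖Du‖_{k,r}`). [folklore] -/
theorem MemContDiffHolder.fderiv {u : E → F} (hu : MemContDiffHolder (k + 1) r u) :
    MemContDiffHolder k r (fderiv ℝ u) := by
  refine MemContDiffHolder.of_eContDiffHolderNorm_lt_top
    (hu.1.fderiv_right (m := k) (by norm_cast)) ?_
  have h := hu.eContDiffHolderNorm_lt_top
  rw [eContDiffHolderNorm_succ_eq_fderiv] at h
  exact lt_of_le_of_lt le_add_self h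

/-- `C^{k+1,r}_b` membership is: `C^{k+1}`, bounded, and `Du ∈ C^{k,r}_b`. [folklore] -/
theorem memContDiffHolder_succ_iff {u : E → F} :
    MemContDiffHolder (k + 1) r u ↔
      ContDiff ℝ (k + 1) u ∧ eSupNorm u < ⊤ ∧ MemContDiffHolder k r (fderiv ℝ u) := by
  constructor
  · intro hu
    exact ⟨hu.1, (eSupNorm_le_eContDiffHolderNorm _ r u).trans_lt hu.eContDiffHolderNorm_lt_top,
      hu.fderiv⟩
  · rintro ⟨h1, h2, h3⟩
    refine MemContDiffHolder.of_eContDiffHolderNorm_lt_top h1 ?_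
    rw [eContDiffHolderNorm_succ_eq_fderiv]
    exact ENNReal.add_lt_top.2 ⟨h2, h3.eContDiffHolderNorm_lt_top⟩

/-- **Order reduction**: `C^{k+1,r}_b ⊆ C^{k,r}_b` for `r ≤ 1` (`‖u‖_{k,r} ≤ 3‖u‖_{k+1,r}`). [folklore] -/
theorem MemContDiffHolder.of_succ (hr : r ≤ 1) {u : E → F} (hu : MemContDiffHolder (k + 1) r u) :
    MemContDiffHolder k r u :=
  MemContDiffHolder.of_eContDiffHolderNorm_lt_top (hu.1.of_le (by exact_mod_cast Nat.le_succ k))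
    (lt_of_le_of_lt (eContDiffHolderNorm_le_three_mul_succ hu.1 hr r)
      (ENNReal.mul_lt_top (by simp) hu.eContDiffHolderNorm_lt_top))

/-- The range of a member lies in a closed ball. [folklore] -/
theorem MemContDiffHolder.exists_norm_le {u : E → F} (hu : MemContDiffHolder k r u) :
    ∃ R : ℝ, ∀ x, ‖u x‖ ≤ R := by
  obtain ⟨R, hR⟩ := eSupNorm_lt_top_iff.1 (hu.2.1 0 (Nat.zero_le k))
  exact ⟨R, fun x => by simpa using hR x⟩

end Shift

/-! ### Post-composition with smooth maps -/

section Comp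

variable {E F : Type u} [NormedAddCommGroup E] [NormedSpace ℝ E] [NormedAddCommGroup F]
  [NormedSpace ℝ F] [FiniteDimensional ℝ F] {r : ℝ≥0}

/-- **The case `k = 0`**: for `φ ∈ C¹(F, G)` (`F` finite-dimensional) and `u ∈ C^{0,r}_b(E, F)`,
`φ ∘ u ∈ C^{0,r}_b(E, G)` — `φ` is bounded and Lipschitz on the compact ball containing the range
of `u` (mean value theorem). [folklore] -/
theorem MemContDiffHolder.comp_left_zero {G : Type u} [NormedAddCommGroup G] [NormedSpace ℝ G]
    {φ : F → G} (hφ : ContDiff ℝ 1 φ) {u : E → F} (hu : MemContDiffHolder 0 r u) :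
    MemContDiffHolder 0 r (φ ∘ u) := by
  obtain ⟨R, hR⟩ := hu.exists_norm_le
  have hK : IsCompact (closedBall (0 : F) R) := isCompact_closedBall 0 R
  have hmem : ∀ x, u x ∈ closedBall (0 : F) R := fun x => by simpa using hR x
  -- `φ` is bounded on the ball
  obtain ⟨C, hC⟩ := hK.exists_bound_of_continuousOn hφ.continuous.continuousOn
  -- `φ` is Lipschitz on the ball
  obtain ⟨L, hL⟩ := hK.exists_bound_of_continuousOn (hφ.continuous_fderiv one_ne_zero).continuousOn
  set L' : ℝ≥0 := ⟨max L 0, le_max_right _ _⟩ with hL'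
  have hLip : LipschitzOnWith L' φ (closedBall (0 : F) R) := by
    refine (convex_closedBall (0 : F) R).lipschitzOnWith_of_nnnorm_fderiv_le
      (fun x _ => (hφ.differentiable one_ne_zero x)) fun x hx => ?_
    rw [← NNReal.coe_le_coe, coe_nnnorm]
    exact (hL x hx).trans (le_max_left _ _)
  refine ⟨?_, fun j hj => ?_, ?_⟩
  · exact (hφ.of_le (by norm_cast)).comp hu.1
  · rw [Nat.le_zero.1 hj, eSupNorm_iteratedFDeriv_zero]
    exact eSupNorm_lt_top_iff.2 ⟨C, fun x => hC (u x) (hmem x)⟩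
  · rw [memHolder_iteratedFDeriv_zero_iff]
    obtain ⟨Cu, hCu⟩ := memHolder_iteratedFDeriv_zero_iff.1 hu.2.2
    refine ⟨L' * Cu, fun x y => ?_⟩
    calc edist (φ (u x)) (φ (u y)) ≤ (L' : ℝ≥0∞) * edist (u x) (u y) := hLip (hmem x) (hmem y)
      _ ≤ (L' : ℝ≥0∞) * ((Cu : ℝ≥0∞) * edist x y ^ (r : ℝ)) := mul_le_mul' le_rfl (hCu x y)
      _ = ((L' * Cu : ℝ≥0) : ℝ≥0∞) * edist x y ^ (r : ℝ) := by rw [ENNReal.coe_mul, mul_assoc]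

/-- **Smooth maps act on `C^{k,r}_b` by post-composition**: for `r ≤ 1`, `F` finite-dimensional,
`φ ∈ C^{k+1}(F, G)` and `u ∈ C^{k,r}_b(E, F)`, the composition `φ ∘ u` is in `C^{k,r}_b(E, G)`.
Induction on `k` (generalizing `G`): `D(φ ∘ u) = (Dφ ∘ u) ∘L Du` is the pairing `compL` of
`Dφ ∘ u ∈ C^{k,r}_b` (hypothesis for `Dφ`) and `Du ∈ C^{k,r}_b` (derivative shift), in `C^{k,r}_b`
by the Leibniz rule (`MemContDiffHolder.bilinear`). [cite: GilbargTrudinger2001, §4.1] -/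
theorem MemContDiffHolder.comp_left (hr : r ≤ 1) :
    ∀ {k : ℕ} {G : Type u} [NormedAddCommGroup G] [NormedSpace ℝ G] {φ : F → G},
      ContDiff ℝ (k + 1) φ → ∀ {u : E → F}, MemContDiffHolder k r u →
        MemContDiffHolder k r (φ ∘ u) := by
  intro k
  induction k with
  | zero =>
    intro G _ _ φ hφ u hu
    exact hu.comp_left_zero hφ
  | succ k ih =>
    intro G _ _ φ hφ u hu
    -- ingredients
    have hφ1 : ContDiff ℝ 1 φ := hφ.of_le (by norm_cast; omega)
    have hu' : MemContDiffHolder k r u := hu.of_succ hr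
    have hDu : MemContDiffHolder k r (_root_.fderiv ℝ u) := hu.fderiv
    have hDφ : ContDiff ℝ (k + 1) (_root_.fderiv ℝ φ) := hφ.fderiv_right (m := k + 1) (by norm_cast)
    have hDφu : MemContDiffHolder k r (_root_.fderiv ℝ φ ∘ u) := ih hDφ hu'
    -- the derivative of the composition is the pairing `compL`
    have hpair : MemContDiffHolder k r fun x =>
        ContinuousLinearMap.compL ℝ E F G ((_root_.fderiv ℝ φ ∘ u) x) (_root_.fderiv ℝ u x) :=
      hDφu.bilinear hr (ContinuousLinearMap.compL ℝ E F G) hDu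
    have hchain : _root_.fderiv ℝ (φ ∘ u) = fun x =>
        ContinuousLinearMap.compL ℝ E F G ((_root_.fderiv ℝ φ ∘ u) x) (_root_.fderiv ℝ u x) := by
      funext x
      rw [ContinuousLinearMap.compL_apply, Function.comp_apply]
      exact fderiv_comp x (hφ1.differentiable one_ne_zero (u x))
        (hu.1.differentiable (by exact_mod_cast Nat.succ_ne_zero k) x)
    -- boundedness of `φ ∘ u`
    obtain ⟨R, hR⟩ := hu.exists_norm_le
    obtain ⟨C, hC⟩ := (isCompact_closedBall (0 : F) R).exists_bound_of_continuousOn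
      hφ.continuous.continuousOn
    refine memContDiffHolder_succ_iff.2
      ⟨(hφ.of_le (by exact_mod_cast Nat.le_succ _)).comp hu.1, ?_, ?_⟩
    · exact eSupNorm_lt_top_iff.2 ⟨C, fun x => hC (u x) (by simpa using hR x)⟩
    · rw [hchain]
      exact hpair

namespace ContDiffHolderFunction

/-- **Post-composition with a smooth map** as an operation on the bundled spaces:
`compLeft hr φ hφ u = φ ∘ u ∈ C^{k,r}_b(E, G)` for `u ∈ C^{k,r}_b(E, F)`, `φ ∈ C^{k+1}`, `r ≤ 1`. [cite: GilbargTrudinger2001, §4.1] -/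
def compLeft (hr : r ≤ 1) {k : ℕ} {G : Type u} [NormedAddCommGroup G] [NormedSpace ℝ G]
    (φ : F → G) (hφ : ContDiff ℝ (k + 1) φ) (u : ContDiffHolderFunction E F k r) :
    ContDiffHolderFunction E G k r :=
  ⟨φ ∘ u, MemContDiffHolder.comp_left hr hφ u.memContDiffHolder⟩

/-- Pointwise: `compLeft hr φ hφ u x = φ (u x)`. [folklore] -/
@[simp]
theorem compLeft_apply (hr : r ≤ 1) {k : ℕ} {G : Type u} [NormedAddCommGroup G] [NormedSpace ℝ G]
    (φ : F → G) (hφ : ContDiff ℝ (k + 1) φ) (u : ContDiffHolderFunction E F k r) (x : E) :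
    compLeft hr φ hφ u x = φ (u x) := rfl

end ContDiffHolderFunction

end Comp

/-! ### Real-valued example: the exponential nonlinearity -/

section Exp

variable {E : Type} [NormedAddCommGroup E] [NormedSpace ℝ E] {k : ℕ} {r : ℝ≥0}

/-- **`u ↦ e^{a u}` maps `C^{k,r}_b(E, ℝ)` to itself** (`r ≤ 1`) — the nonlinearity `q e^{−4w}`
of the weighted `σ₂` path equation read on the background
(`Literature.Geometry.Riemannian.GurskyViaclovskyPath.backgroundPathOperator`). [folklore] -/
def ContDiffHolderFunction.expMul (hr : r ≤ 1) (a : ℝ) (u : ContDiffHolderFunction E ℝ k r) :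
    ContDiffHolderFunction E ℝ k r :=
  ContDiffHolderFunction.compLeft hr (fun t : ℝ => Real.exp (a * t))
    (Real.contDiff_exp.comp (contDiff_const.mul contDiff_id)) u

/-- Pointwise: `expMul hr a u x = exp (a * u x)`. [folklore] -/
@[simp]
theorem ContDiffHolderFunction.expMul_apply (hr : r ≤ 1) (a : ℝ) (u : ContDiffHolderFunction E ℝ k r)
    (x : E) : ContDiffHolderFunction.expMul hr a u x = Real.exp (a * u x) := rfl

end Exp

end Literature.Analysis.FunctionSpaces

end
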